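import Summits.AnomalousDissipation.AnomalousDissipation.Theorems.MomentParityLevelNMeasure
import Summits.AnomalousDissipation.AnomalousDissipation.Theorems.MomentParityPathFunctionals

/-!
# Route MomentParity · crux `GalerkinEnsembleRealization` — line `Sketch`, stub
  `stub_levelEnergyMeanTrunc`

The `P`-mean of the unit-time mean of the truncated energy is at most the mean energy of the
level-`N` ensemble `μ`: with `m = (u ↦ û|_S)_* μ` the law of the coefficients on the Galerkin phase
space and `P = (orbitPathOn)_* m` its push-forward to the trajectory space
`𝒦 = pathSpace R (pathLip ν A R)`,

  `∫ (∫₀¹ ∑_{k ∈ T} ‖ω̄(t, k)‖² dt) dP(ω) ≤ ∫ ‖u‖² dμ(u) = e(μ)`.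

Proof: Fubini on `𝒦 × [0, 1]` (the integrand is continuous and bounded by `R²`); at a fixed time
`t ≥ 0` the `P`-mean of `∑_{k∈T} ‖ω̄(t,k)‖²` is the `m`-mean of `G_T ∘ φ_t`,
`G_T(c) = ∑_{k∈T} ‖c̄ k‖²` (the extension of an orbit path is the orbit), which is the `m`-mean of
`G_T` by invariance of `m` under the Galerkin semiflow, i.e. `∫ G_T(û|_S) dμ(u) ≤ ∫ ‖u‖² dμ(u)`
by Bessel (Foias–Rosa–Temam 2013, arXiv:1111.6257, proof of Thm. 3.1; Foias–Manley–Rosa–Temam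
2001, Ch. IV App. B; stmt-AnomalousDissipation-11466).
-/

noncomputable section

-- every `Summit.AnomalousDissipation.AnomalousDissipation.…` name repeats the summit = sub-problem segment (D-0017 layout)
set_option linter.dupNamespace false

open MeasureTheory Set Filter Topology Function Metric UnitAddTorus
open scoped BigOperators ENNReal InnerProductSpace RealInnerProductSpace

namespace Summit.AnomalousDissipation.AnomalousDissipation.Theorems.MomentParity

open Literature.Analysis.FunctionSpaces Literature.Analysis.FunctionSpaces.Torus
open Literature.Analysis.FluidPDE Literature.Analysis.FluidPDE.Torus

variable {ν : ℝ} {f : UnitAddTorus (Fin 3) → EuclideanSpace ℝ (Fin 3)}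

/-! ### Fubini on the trajectory space -/

/-- **Fubini bound on the trajectory space**: if at every time `t ≥ 0` the `P`-mean of the
truncated energy is at most `E`, then so is the `P`-mean of its unit-time mean (the integrand
`(ω, t) ↦ ∑_{k∈T} ‖ω̄(t,k)‖²` is continuous and bounded by `R²` on `𝒦 × ℝ`). -/
private theorem integral_energyMeanTrunc_le_of_forall {R : ℝ} {L : (Fin 3 → ℤ) → ℝ}
    (P : Measure ↥(pathSpace R L : Set (Path (Fin 3)))) [IsFiniteMeasure P] (T : Finset (Fin 3 → ℤ))
    {E : ℝ} (hE : ∀ t : ℝ, 0 ≤ t → ∫ ω, pathEnergy T ω.1 t ∂P ≤ E) :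
    ∫ ω, energyMeanTrunc T ω.1 ∂P ≤ E := by
  -- the integrand is jointly continuous and bounded on `𝒦 × ℝ`, hence integrable on `𝒦 × (0, 1]`
  have hcont : Continuous fun p : ↥(pathSpace (d := Fin 3) R L) × ℝ => pathEnergy T p.1.1 p.2 :=
    continuous_pathEnergy R L T
  have hint : Integrable (uncurry fun (ω : ↥(pathSpace (d := Fin 3) R L)) (t : ℝ) => pathEnergy T ω.1 t)
      (P.prod (volume.restrict (Ioc (0 : ℝ) 1))) := by
    refine Integrable.of_bound hcont.measurable.aestronglyMeasurable (R ^ 2) (ae_of_all _ fun p => ?_)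
    change ‖pathEnergy T p.1.1 p.2‖ ≤ R ^ 2
    rw [Real.norm_eq_abs, abs_of_nonneg (pathEnergy_nonneg T p.1.1 p.2)]
    exact pathEnergy_le p.1.2 T p.2
  have h1 : ∫ ω, energyMeanTrunc T ω.1 ∂P = ∫ ω, (∫ t in Ioc (0 : ℝ) 1, pathEnergy T ω.1 t) ∂P := by
    refine integral_congr_ae (ae_of_all _ fun ω => ?_)
    simp only [energyMeanTrunc, intervalIntegral.integral_of_le zero_le_one]
  rw [h1, integral_integral_swap hint]
  calc ∫ t in Ioc (0 : ℝ) 1, (∫ ω, pathEnergy T ω.1 t ∂P)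
      ≤ ∫ t in Ioc (0 : ℝ) 1, E := by
        refine integral_mono_of_nonneg (ae_of_all _ fun t => ?_) (integrable_const E) ?_
        · exact integral_nonneg fun ω => pathEnergy_nonneg T ω.1 t
        · filter_upwards [ae_restrict_mem measurableSet_Ioc] with t ht
          exact hE t ht.1.le
    _ = E := by
        rw [setIntegral_const, Real.volume_real_Ioc, sub_zero, max_eq_left zero_le_one, one_smul]

/-! ### The fixed-time identity on the phase space -/

section PhaseSpace

variable {N : ℕ} {g : ↥(freqBall N : Finset (Fin 3 → ℤ)) → EuclideanSpace ℂ (Fin 3)} {R : ℝ}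
  {L : (Fin 3 → ℤ) → ℝ}

/-- The truncated energy read on the phase space, `G_T(c) = ∑_{k∈T} ‖c̄ k‖²`, is continuous. -/
private theorem continuous_sum_norm_coeffExt_sq (T : Finset (Fin 3 → ℤ)) :
    Continuous fun c : ↥(freqBall N : Finset (Fin 3 → ℤ)) → EuclideanSpace ℂ (Fin 3) =>
      ∑ k ∈ T, ‖coeffExt (freqBall N) c k‖ ^ 2 := by
  refine continuous_finsetSum _ fun k _ => ?_
  by_cases hk : k ∈ freqBall (d := Fin 3) N
  · simp_rw [coeffExt_of_mem _ hk]
    exact ((continuous_apply _).norm).pow 2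
  · simp_rw [coeffExt_of_not_mem _ hk, norm_zero]
    exact continuous_const

/-- The time-`t` map of the Galerkin semiflow (`t ≥ 0`) is a.e. measurable for every measure on
the phase space carried by the good set (it is continuous on the closed phase space). -/
private theorem aemeasurable_galerkinCoeffFlow_of_good (hν : 0 ≤ ν) (hg : IsRealCoeff g)
    {m : Measure (↥(freqBall N : Finset (Fin 3 → ℤ)) → EuclideanSpace ℂ (Fin 3))}
    (hm : m {c | c ∈ galerkinSubspace (freqBall N) ∧ orbitPath ν g c ∈ pathSpace R L}ᶜ = 0)
    {t : ℝ} (ht : 0 ≤ t) : AEMeasurable (galerkinCoeffFlow ν g t) m := by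
  have hcont : ContinuousOn (fun c => galerkinCoeffFlow ν g t c)
      ((galerkinSubspace (freqBall (d := Fin 3) N) :
          Submodule ℝ (↥(freqBall (d := Fin 3) N) → EuclideanSpace ℂ (Fin 3))) :
        Set (↥(freqBall (d := Fin 3) N) → EuclideanSpace ℂ (Fin 3))) :=
    (continuousOn_galerkinCoeffFlow hν neg_mem_freqBall_of_mem hg).comp
      (continuousOn_const.prodMk continuousOn_id) fun c hc => ⟨mem_Ici.2 ht, hc⟩
  have hV : ∀ᵐ c ∂m, c ∈ ((galerkinSubspace (freqBall (d := Fin 3) N) :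
      Submodule ℝ (↥(freqBall (d := Fin 3) N) → EuclideanSpace ℂ (Fin 3))) :
        Set (↥(freqBall (d := Fin 3) N) → EuclideanSpace ℂ (Fin 3))) := by
    have : ∀ᵐ c ∂m, c ∈ {c | c ∈ galerkinSubspace (freqBall N) ∧ orbitPath ν g c ∈ pathSpace R L} := by
      rw [ae_iff]; exact hm
    exact this.mono fun c hc => hc.1
  rw [← Measure.restrict_eq_self_of_ae_mem hV]
  exact hcont.aemeasurable (galerkinSubspace (freqBall N)).closed_of_finiteDimensional.measurableSet

/-- **The fixed-time identity**: for a finite measure `m` on the phase space carried by the good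
set and invariant under the time-`t` map (`t ≥ 0`), the `(orbitPathOn)_* m`-mean of the
truncated energy at time `t` is the `m`-mean of `G_T` (the extension of an orbit path is the
orbit, then invariance). -/
private theorem integral_pathEnergy_map_orbitPathOn (hν : 0 ≤ ν) (hg : IsRealCoeff g)
    (ω₀ : ↥(pathSpace R L : Set (Path (Fin 3))))
    {m : Measure (↥(freqBall N : Finset (Fin 3 → ℤ)) → EuclideanSpace ℂ (Fin 3))}
    (hm : m {c | c ∈ galerkinSubspace (freqBall N) ∧ orbitPath ν g c ∈ pathSpace R L}ᶜ = 0)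
    {t : ℝ} (ht : 0 ≤ t) (hinv : m.map (galerkinCoeffFlow ν g t) = m) (T : Finset (Fin 3 → ℤ)) :
    ∫ ω, pathEnergy T ω.1 t ∂(m.map (orbitPathOn ν g R L ω₀)) =
      ∫ c, ∑ k ∈ T, ‖coeffExt (freqBall N) c k‖ ^ 2 ∂m := by
  have hS : ∀ k ∈ freqBall (d := Fin 3) N, -k ∈ freqBall (d := Fin 3) N := neg_mem_freqBall_of_mem
  have hcontω : Continuous fun ω : ↥(pathSpace (d := Fin 3) R L) => pathEnergy T ω.1 t := by
    unfold pathEnergy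
    exact continuous_finsetSum _ fun k _ => ((continuous_pathExt_subtype R L t k).norm).pow 2
  rw [integral_map (aemeasurable_orbitPathOn hν hg ω₀ hm) hcontω.aestronglyMeasurable]
  -- on the good set the integrand is `G_T ∘ φ_t`
  have hgood : ∀ᵐ c ∂m, c ∈ {c | c ∈ galerkinSubspace (freqBall N) ∧ orbitPath ν g c ∈ pathSpace R L} := by
    rw [ae_iff]; exact hm
  have hae : (fun c => pathEnergy T (orbitPathOn ν g R L ω₀ c : Path (Fin 3)) t) =ᵐ[m]
      fun c => ∑ k ∈ T, ‖coeffExt (freqBall N) (galerkinCoeffFlow ν g t c) k‖ ^ 2 := by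
    filter_upwards [hgood] with c hc
    simp only [pathEnergy, coe_orbitPathOn_of_mem _ _ _ _ _ hc.2]
    exact Finset.sum_congr rfl fun k _ => by rw [pathExt_orbitPath hν hS hg hc.1 hc.2 ht k]
  calc ∫ c, pathEnergy T (orbitPathOn ν g R L ω₀ c : Path (Fin 3)) t ∂m
      = ∫ c, ∑ k ∈ T, ‖coeffExt (freqBall N) (galerkinCoeffFlow ν g t c) k‖ ^ 2 ∂m :=
        integral_congr_ae hae
    _ = ∫ c, ∑ k ∈ T, ‖coeffExt (freqBall N) c k‖ ^ 2 ∂(m.map (galerkinCoeffFlow ν g t)) :=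
        (integral_map (aemeasurable_galerkinCoeffFlow_of_good hν hg hm ht)
          (continuous_sum_norm_coeffExt_sq T).aestronglyMeasurable).symm
    _ = ∫ c, ∑ k ∈ T, ‖coeffExt (freqBall N) c k‖ ^ 2 ∂m := by rw [hinv]

end PhaseSpace

/-! ### Bessel on `H` -/

/-- **Bessel**: `∑_{k∈T} ‖(û|_S)‾ k‖² ≤ ‖u‖²` for `u ∈ H`. -/
private theorem sum_norm_coeffExt_fourierRestrict_sq_le_norm_sq {N : ℕ} (T : Finset (Fin 3 → ℤ))
    (u : Torus.energySpace (Fin 3)) :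
    ∑ k ∈ T, ‖coeffExt (freqBall N) (fourierRestrict (freqBall N)
        (u.1 : UnitAddTorus (Fin 3) → EuclideanSpace ℝ (Fin 3))) k‖ ^ 2 ≤ ‖u‖ ^ 2 := by
  have hB : ∀ k ∈ T, ‖coeffExt (freqBall N) (fourierRestrict (freqBall N)
      (u.1 : UnitAddTorus (Fin 3) → EuclideanSpace ℝ (Fin 3))) k‖ ^ 2 ≤
      ‖mFourierCoeff (EuclideanSpace.complexify ∘
        (u.1 : UnitAddTorus (Fin 3) → EuclideanSpace ℝ (Fin 3))) k‖ ^ 2 := by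
    intro k _
    by_cases hk : k ∈ freqBall (d := Fin 3) N
    · rw [coeffExt_of_mem _ hk, fourierRestrict_apply]
    · rw [coeffExt_of_not_mem _ hk, norm_zero, zero_pow two_ne_zero]
      exact sq_nonneg _
  refine (Finset.sum_le_sum hB).trans ?_
  have h2 := sum_le_hasSum T (fun k _ => sq_nonneg _)
    (hasSum_sq_norm_mFourierCoeff_complexify (Lp.memLp u.1))
  have h3 : ∫ x, ‖(u.1 : UnitAddTorus (Fin 3) → EuclideanSpace ℝ (Fin 3)) x‖ ^ 2 = ‖u‖ ^ 2 :=
    integral_norm_sq_coe_eq u.1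
  linarith

/-! ### The stub -/

/-- **Stub (level law, truncated energy ceiling by Fubini, invariance and Bessel).** For the
level-`N` ensemble `μ` (band-limited to the ball `S = freqBall N`, carried by `|u| ≤ R`,
annihilating the Foias–Prodi generator on band-limited cylindrical tests), the law
`P = (orbitPathOn)_* (u ↦ û|_S)_* μ` on the trajectory space satisfies
`∫ (∫₀¹ ∑_{k∈T} ‖ω̄(t,k)‖² dt) dP(ω) ≤ e(μ) = ∫ ‖u‖² dμ(u)` for every finite `T`. -/
theorem stub_levelEnergyMeanTrunc (hν : 0 < ν) (hf : IsSmooth f) (hf0 : HasZeroMean f) {N : ℕ}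
    {R A : ℝ}
    (hA : ∀ k, ‖coeffExt (freqBall N) (fourierRestrict (freqBall N) f) k‖ ≤ A) (hA0 : 0 ≤ A)
    (ω₀ : ↥(pathSpace R (pathLip ν A R) : Set (Path (Fin 3))))
    {μ : Measure (Torus.energySpace (Fin 3))} [IsProbabilityMeasure μ]
    (h1 : ∀ᵐ u ∂μ, ∀ k ∉ (freqBall N).erase (0 : Fin 3 → ℤ),
      mFourierCoeff (EuclideanSpace.complexify ∘ (u.1 : UnitAddTorus (Fin 3) → EuclideanSpace ℝ (Fin 3))) k = 0)
    (h2 : ∀ᵐ u ∂μ, ‖u‖ ≤ R)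
    (h4 : ∀ Φ : CylindricalTest (Fin 3),
      (∀ i, ∀ k ∉ (freqBall N).erase (0 : Fin 3 → ℤ),
        mFourierCoeff (EuclideanSpace.complexify ∘ (Φ.g i)) k = 0) →
        Integrable (fun u => nsGeneratorPairing ν f u (Φ.grad u)) μ ∧
          ∫ u, nsGeneratorPairing ν f u (Φ.grad u) ∂μ = 0)
    (T : Finset (Fin 3 → ℤ)) :
    ∫ ω, energyMeanTrunc T ω.1 ∂((μ.map fun u : Torus.energySpace (Fin 3) =>
        fourierRestrict (freqBall N) (u.1 : UnitAddTorus (Fin 3) → EuclideanSpace ℝ (Fin 3))).map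
        (orbitPathOn ν (fourierRestrict (freqBall N) f) R (pathLip ν A R) ω₀)) ≤
      ensembleEnergy μ := by
  have hg : IsRealCoeff (fourierRestrict (freqBall N) f) := isRealCoeff_mFourierCoeff hf.integrable
  have hm := map_coeff_compl_good_eq_zero hν (hf.memLp 2) hf0 hA hA0 h1 h2 h4
  refine integral_energyMeanTrunc_le_of_forall _ T fun t ht => ?_
  rw [integral_pathEnergy_map_orbitPathOn hν.le hg ω₀ hm ht
      (map_coeff_invariant hν (hf.memLp 2) hf0 h1 h2 h4 ht) T,
    integral_map (continuous_fourierRestrict_coe N).measurable.aemeasurable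
      (continuous_sum_norm_coeffExt_sq T).aestronglyMeasurable]
  -- Bessel under the integral sign; `‖u‖²` is `μ`-integrable since `‖u‖ ≤ R` a.e.
  unfold ensembleEnergy
  have hnorm : Integrable (fun u : Torus.energySpace (Fin 3) => ‖u‖ ^ 2) μ := by
    refine Integrable.of_bound (continuous_norm.pow 2).measurable.aestronglyMeasurable (R ^ 2) ?_
    filter_upwards [h2] with u hu
    rw [Real.norm_eq_abs, abs_of_nonneg (sq_nonneg _)]
    exact pow_le_pow_left₀ (norm_nonneg _) hu 2
  exact integral_mono_of_nonneg (ae_of_all _ fun u => Finset.sum_nonneg fun _ _ => sq_nonneg _) hnorm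
    (ae_of_all _ fun u => sum_norm_coeffExt_fourierRestrict_sq_le_norm_sq T u)

end Summit.AnomalousDissipation.AnomalousDissipation.Theorems.MomentParity
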